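import Summits.RiemannHypothesis.RiemannHypothesis.Theorems.WeilColumnThetaWitness
import HarnessLib

/-!
# The PART XIX profile is `C¹`; termwise derivative of its theta series (inputs of THETA-CERT §D2/§D3)

WEIL column (LADDER-RH, W-P(P2); tier-1 `ThetaCertificateSound`, analytic layer, THETA-ASSIGN v1.0 §3 items D2/W2; this seat).
* §1 `hasDerivAt_profile`: for `h = profile c₁ m₀ c₂ ε α m` (`WeilColumnBSplineFourier`),
  `h′(y) = (ρ(y−m₀) − ρ(y−(c₂−ε))) − α·(ρ(y−(c₁+ε)) − ρ(y−m₀))` with `ρ = profileDensity ε m = bsplineDensity (ε/m) (m−1)`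
  (FTC on the moving window `∫_{y−t}^{y−s} ρ`; needs `ρ` CONTINUOUS, i.e. `m ≥ 2` — the lane's `WeilColumnBSplineContinuity`);
  `continuous_profileDeriv`, `profileDeriv_eq_zero` (support in `[c₁, c₂]`).
* §3 `hasDerivAt_thetaSum_scaled`: for a `C¹` profile `h` with `h, h′` vanishing off `[c₁, c₂] ⊂ (0,∞)` and `λ > 0`, the theta
  series `Θ(u) = Σ_{n≥1} h(nu/λ)` is differentiable at every `u > 0` and `u·Θ′(u) = Σ_{n≥1} φ(nu/λ)`, `φ(y) = y·h′(y)` (both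
  locally finite sums, `ProfileHyp.thetaSum_eq_sum`).
The Fourier bound of `φ` and the majorant `‖uΘ′(u)‖ ≤ M₁(u/u₁)^{m−1}` (D2 proper) follow in `WeilColumnThetaMajorantD2`
(inputs `WeilColumnBSplineMoment`). RH-free; nothing here bears on the truth of RH.
-/

set_option linter.dupNamespace false

noncomputable section

open MeasureTheory Set Complex Filter intervalIntegral
open scoped Real FourierTransform Topology
open Literature.NumberTheory.LFunctions

namespace Summit.RiemannHypothesis.RiemannHypothesis.Theorems.WeilColumn.ThetaMellin

/-! ## §1 The derivative of the profile -/

/-- `(a·1_{[s,t]} ⋆ ρ)(y) = a·∫_{y−t}^{y−s} ρ` for `s ≤ t` and `ρ` integrable. [folklore] -/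
theorem weilConv_indicatorConst_apply {s t : ℝ} (hst : s ≤ t) (a : ℂ) {ρ : ℝ → ℂ} (y : ℝ) :
    weilConv (indicatorConst s t a) ρ y = a * ∫ v in (y - t)..(y - s), ρ v := by
  rw [weilConv_apply]
  have e : (fun u : ℝ => indicatorConst s t a u * ρ (y - u)) = Set.indicator (Icc s t) fun u => a * ρ (y - u) := by
    funext u
    unfold indicatorConst
    by_cases hu : u ∈ Icc s t
    · rw [indicator_of_mem hu, indicator_of_mem hu]
    · rw [indicator_of_notMem hu, indicator_of_notMem hu, zero_mul]
  rw [e, MeasureTheory.integral_indicator measurableSet_Icc, integral_Icc_eq_integral_Ioc,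
    ← intervalIntegral.integral_of_le hst, intervalIntegral.integral_const_mul,
    intervalIntegral.integral_comp_sub_left (fun v => ρ v) y]


/-- FTC for the moving window: `d/dy ∫_{y−t}^{y−s} ρ = ρ(y−s) − ρ(y−t)` for continuous `ρ`. [folklore] -/
theorem hasDerivAt_integral_window {ρ : ℝ → ℂ} (hρ : Continuous ρ) (s t y : ℝ) :
    HasDerivAt (fun z : ℝ => ∫ v in (z - t)..(z - s), ρ v) (ρ (y - s) - ρ (y - t)) y := by
  have hint : ∀ a b : ℝ, IntervalIntegrable ρ volume a b := fun a b => hρ.intervalIntegrable a b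
  have hF : ∀ z : ℝ, HasDerivAt (fun w : ℝ => ∫ v in (0 : ℝ)..w, ρ v) (ρ z) z := fun z =>
    intervalIntegral.integral_hasDerivAt_right (hint 0 z) (hρ.stronglyMeasurableAtFilter _ _) hρ.continuousAt
  have e : (fun z : ℝ => ∫ v in (z - t)..(z - s), ρ v) =
      fun z => (∫ v in (0 : ℝ)..(z - s), ρ v) - ∫ v in (0 : ℝ)..(z - t), ρ v := by
    funext z
    rw [intervalIntegral.integral_interval_sub_left (hint _ _) (hint _ _)]
  rw [e]
  have h1 : HasDerivAt (fun z : ℝ => ∫ v in (0 : ℝ)..(z - s), ρ v) (ρ (y - s)) y :=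
    HasDerivAt.comp_sub_const y s (hF (y - s))
  have h2 : HasDerivAt (fun z : ℝ => ∫ v in (0 : ℝ)..(z - t), ρ v) (ρ (y - t)) y :=
    HasDerivAt.comp_sub_const y t (hF (y - t))
  exact h1.sub h2

/-- `d/dy (a·1_{[s,t]} ⋆ ρ)(y) = a·(ρ(y−s) − ρ(y−t))` for continuous `ρ`. [folklore] -/
theorem hasDerivAt_weilConv_indicatorConst {s t : ℝ} (hst : s ≤ t) (a : ℂ) {ρ : ℝ → ℂ} (hρ : Continuous ρ) (y : ℝ) :
    HasDerivAt (weilConv (indicatorConst s t a) ρ) (a * (ρ (y - s) - ρ (y - t))) y := by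
  have e : weilConv (indicatorConst s t a) ρ = fun z => a * ∫ v in (z - t)..(z - s), ρ v :=
    funext fun z => weilConv_indicatorConst_apply hst a z
  rw [e]
  exact (hasDerivAt_integral_window hρ s t y).const_mul a

/-- The B-spline smoothing density of the profile: `ρ_ε = bsplineDensity (ε/m) (m−1)`. -/
def profileDensity (ε : ℝ) (m : ℕ) : ℝ → ℂ := bsplineDensity (ε / m) (m - 1)

/-- The derivative of the profile: `h′(y) = (ρ(y−m₀) − ρ(y−(c₂−ε))) − α·(ρ(y−(c₁+ε)) − ρ(y−m₀))`, `ρ = profileDensity ε m`. -/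
def profileDeriv (c₁ m₀ c₂ ε α : ℝ) (m : ℕ) (y : ℝ) : ℂ :=
  (profileDensity ε m (y - m₀) - profileDensity ε m (y - (c₂ - ε)))
    - (α : ℂ) * (profileDensity ε m (y - (c₁ + ε)) - profileDensity ε m (y - m₀))

/-- `weilConv` is subtractive in the first argument when both convolution integrands are integrable at the point. [folklore] -/
theorem weilConv_sub_left_apply {f g ρ : ℝ → ℂ} {y : ℝ} (hf : Integrable fun u => f u * ρ (y - u))
    (hg : Integrable fun u => g u * ρ (y - u)) : weilConv (f - g) ρ y = weilConv f ρ y - weilConv g ρ y := by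
  rw [weilConv_apply, weilConv_apply, weilConv_apply, ← integral_sub hf hg]
  refine integral_congr_ae (Eventually.of_forall fun u => ?_)
  simp only [Pi.sub_apply]
  ring

/-- The convolution integrand `u ↦ a·1_{[s,t]}(u)·ρ(y − u)` is integrable for integrable `ρ`. [folklore] -/
theorem integrable_indicatorConst_mul_comp_sub (s t : ℝ) (a : ℂ) {ρ : ℝ → ℂ} (hρ : Integrable ρ) (y : ℝ) :
    Integrable fun u => indicatorConst s t a u * ρ (y - u) := by
  refine (hρ.comp_sub_left y).bdd_mul (c := ‖a‖) ?_ (Eventually.of_forall fun u => ?_)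
  · exact (measurable_const.indicator measurableSet_Icc).aestronglyMeasurable
  · unfold indicatorConst
    by_cases hu : u ∈ Icc s t
    · rw [indicator_of_mem hu]
    · rw [indicator_of_notMem hu, norm_zero]; exact norm_nonneg _

/-- **The profile is `C¹`**: `HasDerivAt (profile c₁ m₀ c₂ ε α m) (profileDeriv c₁ m₀ c₂ ε α m y) y`, for `c₁ + ε ≤ m₀ ≤ c₂ − ε`
and a CONTINUOUS smoothing density (`m ≥ 2`, the lane's `WeilColumnBSplineContinuity`). [folklore] -/
theorem hasDerivAt_profile {c₁ m₀ c₂ ε α : ℝ} {m : ℕ} (h1 : m₀ ≤ c₂ - ε) (h2 : c₁ + ε ≤ m₀)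
    (hρ : Continuous (profileDensity ε m)) (y : ℝ) :
    HasDerivAt (profile c₁ m₀ c₂ ε α m) (profileDeriv c₁ m₀ c₂ ε α m y) y := by
  have hρi : Integrable (profileDensity ε m) := integrable_bsplineDensity _ _
  have e : profile c₁ m₀ c₂ ε α m = fun z =>
      weilConv (indicatorConst m₀ (c₂ - ε) 1) (profileDensity ε m) z
        - weilConv (indicatorConst (c₁ + ε) m₀ (α : ℂ)) (profileDensity ε m) z := by
    funext z
    rw [profile, stepProfile]
    exact weilConv_sub_left_apply (integrable_indicatorConst_mul_comp_sub _ _ _ hρi z)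
      (integrable_indicatorConst_mul_comp_sub _ _ _ hρi z)
  rw [e]
  have d1 := hasDerivAt_weilConv_indicatorConst h1 (1 : ℂ) hρ y
  have d2 := hasDerivAt_weilConv_indicatorConst h2 (α : ℂ) hρ y
  refine (d1.sub d2).congr_deriv ?_
  simp only [profileDeriv, one_mul]

/-- `h′` is continuous (for a continuous smoothing density). [folklore] -/
theorem continuous_profileDeriv (c₁ m₀ c₂ ε α : ℝ) {m : ℕ} (hρ : Continuous (profileDensity ε m)) :
    Continuous (profileDeriv c₁ m₀ c₂ ε α m) := by
  unfold profileDeriv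
  fun_prop

/-- `h′` vanishes off `[c₁, c₂]` (each `ρ(· − tᵢ)` lives in `[tᵢ − ε, tᵢ + ε] ⊆ [c₁, c₂]`; `ε ≥ 0`, `m ≥ 1`). [folklore] -/
theorem profileDeriv_eq_zero {c₁ m₀ c₂ ε α : ℝ} {m : ℕ} (hm : 1 ≤ m) (hε : 0 ≤ ε) (h1 : m₀ ≤ c₂ - ε) (h2 : c₁ + ε ≤ m₀)
    {y : ℝ} (hy : y ∉ Icc c₁ c₂) : profileDeriv c₁ m₀ c₂ ε α m y = 0 := by
  have hsupp : ∀ t : ℝ, c₁ + ε ≤ t → t ≤ c₂ - ε → profileDensity ε m (y - t) = 0 := by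
    intro t ht1 ht2
    have hsub := support_bsplineDensity_subset (c := ε / m) (by positivity) (m - 1)
    by_contra hne
    have hmem := hsub (Function.mem_support.mpr hne)
    have hm' : (((m - 1 : ℕ) : ℝ) + 1) * (ε / m) = ε := by
      have : ((m - 1 : ℕ) : ℝ) + 1 = m := by
        rw [Nat.cast_sub hm]; push_cast; ring
      rw [this]; field_simp
    rw [hm'] at hmem
    rw [mem_Icc, not_and_or, not_le, not_le] at hy
    rcases hy with hy | hy
    · linarith [hmem.1]
    · linarith [hmem.2]
  unfold profileDeriv
  rw [hsupp m₀ h2 h1, hsupp (c₂ - ε) (by linarith) le_rfl, hsupp (c₁ + ε) le_rfl (by linarith)]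
  ring


/-! ## §3 The derivative of the theta series of a `C¹` profile (locally finite sum) -/

section ThetaDeriv

variable {h h' : ℝ → ℂ} {c₁ c₂ lam : ℝ}

/-- A `C¹` profile scaled by `λ`: `G(y) = h(y/λ)` has derivative `λ⁻¹·h′(y/λ)`. [folklore] -/
theorem hasDerivAt_scaled (hh : ∀ y, HasDerivAt h (h' y) y) (lam y : ℝ) :
    HasDerivAt (fun z : ℝ => h (z / lam)) ((lam⁻¹ : ℂ) * h' (y / lam)) y := by
  have hd : HasDerivAt (fun z : ℝ => z / lam) (lam⁻¹) y := by
    simpa [div_eq_mul_inv] using (hasDerivAt_id y).mul_const lam⁻¹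
  have := (hh (y / lam)).scomp y hd
  simp only [Function.comp_def, Complex.real_smul, Complex.ofReal_inv] at this
  exact this

/-- `ProfileHyp` for the scaled profile `h(·/λ)` when `h` is continuous and vanishes off `[c₁, c₂] ⊂ (0,∞)`. [folklore] -/
theorem profileHyp_scaled (hc : Continuous h) (h0 : 0 < c₁) (hle : c₁ ≤ c₂) (hz : ∀ y, y ∉ Icc c₁ c₂ → h y = 0)
    (hlam : 0 < lam) : ProfileHyp (fun z : ℝ => h (z / lam)) (lam * c₁) (lam * c₂) where
  cont := hc.comp (continuous_id.div_const lam)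
  pos := mul_pos hlam h0
  le := mul_le_mul_of_nonneg_left hle hlam.le
  zero := fun t ht => hz _ fun hmem => ht
    ⟨by have := (le_div_iff₀ hlam).mp hmem.1; linarith, by have := (div_le_iff₀ hlam).mp hmem.2; linarith⟩

/-- **Termwise differentiation of the theta series.** If `h` is `C¹` with `h, h′` vanishing off `[c₁, c₂] ⊂ (0, ∞)` and `λ > 0`,
then for every `u > 0` the theta series `Θ(u) = Σ_{n≥1} h(nu/λ)` is differentiable at `u` and
**`u·Θ′(u) = Σ_{n≥1} φ(nu/λ)`** with `φ(y) = y·h′(y)` (both series are finite sums near `u`: `ProfileHyp.thetaSum_eq_sum`). [folklore] -/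
theorem hasDerivAt_thetaSum_scaled (hh : ∀ y, HasDerivAt h (h' y) y) (hc' : Continuous h') (h0 : 0 < c₁) (hle : c₁ ≤ c₂)
    (hz : ∀ y, y ∉ Icc c₁ c₂ → h y = 0) (hz' : ∀ y, y ∉ Icc c₁ c₂ → h' y = 0) (hlam : 0 < lam) {u : ℝ} (hu : 0 < u) :
    ∃ D : ℂ, HasDerivAt (thetaSum fun z : ℝ => h (z / lam)) D u ∧
      (u : ℂ) * D = thetaSum (fun z : ℝ => ((z / lam : ℝ) : ℂ) * h' (z / lam)) u := by
  have hcont : Continuous h := continuous_iff_continuousAt.mpr fun y => (hh y).continuousAt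
  have hG : ProfileHyp (fun z : ℝ => h (z / lam)) (lam * c₁) (lam * c₂) := profileHyp_scaled hcont h0 hle hz hlam
  have hΦ : ProfileHyp (fun z : ℝ => ((z / lam : ℝ) : ℂ) * h' (z / lam)) (lam * c₁) (lam * c₂) :=
    profileHyp_scaled (h := fun y : ℝ => (y : ℂ) * h' y) (Complex.continuous_ofReal.mul hc') h0 hle
      (fun y hy => by simp [hz' y hy]) hlam
  set N : ℕ := ⌈2 * (lam * c₂) / u⌉₊ + 1 with hN
  -- near `u` the theta series is the finite sum
  have hev : (thetaSum fun z : ℝ => h (z / lam)) =ᶠ[𝓝 u]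
      fun t => ∑ n ∈ Finset.range N, h ((((n + 1 : ℕ) : ℝ) * t) / lam) := by
    filter_upwards [Ioi_mem_nhds (by linarith : u / 2 < u)] with t ht
    exact hG.thetaSum_eq_sum hu ht
  -- derivative of the finite sum
  have hsum : HasDerivAt (fun t : ℝ => ∑ n ∈ Finset.range N, h ((((n + 1 : ℕ) : ℝ) * t) / lam))
      (∑ n ∈ Finset.range N, (((n + 1 : ℕ) : ℝ) : ℂ) * ((lam⁻¹ : ℂ) * h' ((((n + 1 : ℕ) : ℝ) * u) / lam))) u := by
    refine HasDerivAt.fun_sum (u := Finset.range N) (A := fun n t => h ((((n + 1 : ℕ) : ℝ) * t) / lam))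
      (A' := fun n => (((n + 1 : ℕ) : ℝ) : ℂ) * ((lam⁻¹ : ℂ) * h' ((((n + 1 : ℕ) : ℝ) * u) / lam))) fun n _ => ?_
    have hlin : HasDerivAt (fun t : ℝ => ((n + 1 : ℕ) : ℝ) * t) (((n + 1 : ℕ) : ℝ)) u := by
      simpa using (hasDerivAt_id (𝕜 := ℝ) u).const_mul (((n + 1 : ℕ) : ℝ))
    have := (hasDerivAt_scaled hh lam ((((n + 1 : ℕ) : ℝ) * u))).scomp u hlin
    simp only [Function.comp_def, Complex.real_smul] at this
    exact this
  refine ⟨_, hsum.congr_of_eventuallyEq hev, ?_⟩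
  rw [hΦ.thetaSum_eq_sum hu (by linarith : u / 2 < u), Finset.mul_sum]
  refine Finset.sum_congr rfl fun n _ => ?_
  have hl : (lam : ℂ) ≠ 0 := by exact_mod_cast hlam.ne'
  push_cast
  field_simp

end ThetaDeriv

end Summit.RiemannHypothesis.RiemannHypothesis.Theorems.WeilColumn.ThetaMellin
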